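import Summits.CriticalPhenomena.PercolationContinuityZ3.Theorems.PercLowPointHalfSpaceQuantitativeBGNWallTwoGhostFatou
import Literature.Probability.Percolation.TwoGhostSpace
import HarnessLib

/-!
# `QuantitativeBGN` (stmt-CriticalPhenomena-0913), line `longrange-wall-ghost-bootstrap` — K1, the AKN exchange

Part of the stub `stub_wallTwoGhost` (K1, basic two-ghost inequality on the wall; template
`Literature/Probability/Percolation/TwoGhostInequalityProofs.lean`, Step 1 = Hutchcroft 2020, proof of
Lemma 3.1, eqs. (3.1)–(3.4)). At the wall bond `e = {0, x}` of the augmented model, with the ghost field on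
the wall FOOTPRINT integrated out (weights `w(F) = 1 - e^{-F/n}`, `TwoGhost.wt`), namespace
`…Theorems.WallTwoGhost`:

* resampling one coordinate of an inhomogeneous product measure: `E[1(i ∈ ω) F] = w_i E[F]` for `F` not
  depending on `ω(i)` (`lintegral_mem_mul_of_flip`, via the independence of the coordinate σ-algebras
  `coordSigma` of `Literature/Probability/Percolation/TwoGhostSpace.lean`);
* the weights `finWH`, `WfH`, `WfinH` of `H`-clusters and the integrands `Tgt` (target), `Ncl`, `Nop`
  (weighted counts of finite clusters at the closed/open bond) and `Gfl` (independent of `ω(e)`), their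
  measurability, the pointwise inequality `Tgt + 1(e closed) G_e ≤ N^cl_e` (`Tgt_add_le`), and
  **Step 1**: `E[Tgt_e] + ((1-q)/q) E[N^op_e] ≤ E[N^cl_e]` (`lintegral_Tgt_add_le`, registered as
  `wallTwoGhost_akn_step`).
-/

noncomputable section

namespace Summit.CriticalPhenomena.PercolationContinuityZ3.Theorems

open MeasureTheory Filter Literature.Probability.Percolation Literature.Probability.LatticeModels
open Summit.CriticalPhenomena.PercolationContinuityZ3.Theorems.WallGhost
open scoped ENNReal

namespace WallTwoGhost
/-! ### Step 1: the AKN exchange at one wall bond (Hutchcroft 2020, proof of Lemma 3.1) -/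

section AKN

open TwoGhost

/-! #### Resampling one coordinate of a product measure -/

/-- **Resampling one coordinate** of `prodBernoulli w`: if `F` does not depend on the coordinate `i`,
then `E[1(i ∈ ω) F] = w_i E[F]`. [cite: Hutchcroft2020Locality, §3, proof of Lemma 3.1 (eq. (3.3))] -/
theorem lintegral_mem_mul_of_flip {ι : Type*} (w : ι → unitInterval) (i : ι) {F : Set ι → ℝ≥0∞}
    (hF : Measurable F) (hflip : ∀ ω, F (ω \ {i}) = F ω) :
    ∫⁻ ω, ({ω : Set ι | i ∈ ω}).indicator 1 ω * F ω ∂(prodBernoulli w) =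
      ENNReal.ofReal (w i) * ∫⁻ ω, F ω ∂(prodBernoulli w) := by
  set P := prodBernoulli w with hP
  have hF' : F = fun ω => F (ω ∩ {i}ᶜ) := by funext ω; rw [← Set.sdiff_eq, hflip]
  have hg : Measurable[coordSigma ({i}ᶜ : Set ι)] F := by
    rw [hF']; exact measurable_comp_inter_coordSigma _ hF
  have hdet : DeterminedBy {ω : Set ι | i ∈ ω} ({i} : Set ι) := by
    rw [determinedBy_iff]; intro ω ω' hω
    have := Set.ext_iff.1 hω i
    simp only [Set.mem_inter_iff, Set.mem_singleton_iff, and_true] at this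
    exact this
  have hA : MeasurableSet[coordSigma ({i} : Set ι)] {ω : Set ι | i ∈ ω} :=
    hdet.measurableSet_coordSigma (measurableSet_mem i)
  have hf : Measurable[coordSigma ({i} : Set ι)]
      (fun ω : Set ι => ({ω : Set ι | i ∈ ω}).indicator (1 : Set ι → ℝ≥0∞) ω) :=
    (@measurable_const ℝ≥0∞ (Set ι) _ (coordSigma ({i} : Set ι)) 1).indicator hA
  have hind : ProbabilityTheory.IndepFun (fun ω : Set ι => ({ω : Set ι | i ∈ ω}).indicator (1 : Set ι → ℝ≥0∞) ω) F P :=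
    prodBernoulli_indepFun_of_coordSigma w disjoint_compl_right hf hg
  have hfm : Measurable fun ω : Set ι => ({ω : Set ι | i ∈ ω}).indicator (1 : Set ι → ℝ≥0∞) ω :=
    measurable_const.indicator (measurableSet_mem i)
  have h := ProbabilityTheory.lintegral_mul_eq_lintegral_mul_lintegral_of_indepFun' hfm.aemeasurable hF.aemeasurable hind
  simp only [Pi.mul_apply] at h
  rw [h, lintegral_indicator_one (measurableSet_mem i)]
  congr 1
  rw [← ofReal_measureReal (measure_ne_top P _)]
  congr 1
  exact prodBernoulli_real_setOf_mem w i

/-- Companion: `E[1(i ∉ ω) F] = (1 - w_i) E[F]` (for `E[F] < ∞`).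
[cite: Hutchcroft2020Locality, §3, proof of Lemma 3.1 (eq. (3.3))] -/
theorem lintegral_notMem_mul_of_flip {ι : Type*} (w : ι → unitInterval) (i : ι) {F : Set ι → ℝ≥0∞}
    (hF : Measurable F) (hflip : ∀ ω, F (ω \ {i}) = F ω) (hfin : ∫⁻ ω, F ω ∂(prodBernoulli w) ≠ ∞) :
    ∫⁻ ω, ({ω : Set ι | i ∉ ω}).indicator 1 ω * F ω ∂(prodBernoulli w) =
      ENNReal.ofReal (1 - w i) * ∫⁻ ω, F ω ∂(prodBernoulli w) := by
  set P := prodBernoulli w with hP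
  have hsplit : ∀ ω : Set ι, F ω = {ω : Set ι | i ∈ ω}.indicator 1 ω * F ω + {ω : Set ι | i ∉ ω}.indicator 1 ω * F ω := by
    intro ω
    by_cases h : i ∈ ω
    · simp [Set.indicator_of_mem (show ω ∈ {ω : Set ι | i ∈ ω} from h),
        Set.indicator_of_notMem (show ω ∉ {ω : Set ι | i ∉ ω} from fun h' => h' h)]
    · simp [Set.indicator_of_notMem (show ω ∉ {ω : Set ι | i ∈ ω} from h),
        Set.indicator_of_mem (show ω ∈ {ω : Set ι | i ∉ ω} from h)]
  have htot : ∫⁻ ω, F ω ∂P = ENNReal.ofReal (w i) * ∫⁻ ω, F ω ∂P + ∫⁻ ω, {ω : Set ι | i ∉ ω}.indicator 1 ω * F ω ∂P := by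
    conv_lhs => rw [lintegral_congr hsplit]
    have hm1 : Measurable fun ω : Set ι => {ω : Set ι | i ∈ ω}.indicator 1 ω * F ω :=
      ((measurable_const (a := (1 : ℝ≥0∞))).indicator (measurableSet_mem i)).mul hF
    rw [lintegral_add_left hm1, lintegral_mem_mul_of_flip w i hF hflip]
  have hp1 : ENNReal.ofReal (1 - w i) = 1 - ENNReal.ofReal (w i) := by
    rw [ENNReal.ofReal_sub _ (w i).2.1, ENNReal.ofReal_one]
  rw [hp1, ENNReal.sub_mul fun _ _ => hfin, one_mul]
  refine ENNReal.eq_sub_of_add_eq' hfin ?_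
  rw [add_comm]; exact htot.symm

/-! #### Weights of `H`-clusters -/

open Classical in
/-- `w(F(U)) 1(U finite)`: the ghost weight of a vertex set through its wall footprint `F(U) = |U ∩ ∂H|`.
[cite: Hutchcroft2020Locality, §1.1 (ghost field) and Cor. 1.7 (proof)] -/
def finWH (n : ℕ) (U : Set (Site 3)) : ℝ≥0∞ :=
  if U.Finite then ENNReal.ofReal (wt n (U ∩ {v | v 0 = 0}).ncard) else 0

/-- `finWH` of a finite set. [folklore] -/
theorem finWH_of_finite {n : ℕ} {U : Set (Site 3)} (h : U.Finite) :
    finWH n U = ENNReal.ofReal (wt n (U ∩ {v | v 0 = 0}).ncard) := by simp [finWH, h]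

/-- `finWH` of an infinite set vanishes. [folklore] -/
theorem finWH_of_infinite {n : ℕ} {U : Set (Site 3)} (h : ¬ U.Finite) : finWH n U = 0 := by simp [finWH, h]

/-- `finWH ≤ 1`. [folklore] -/
theorem finWH_le_one (n : ℕ) (U : Set (Site 3)) : finWH n U ≤ 1 := by
  by_cases h : U.Finite
  · rw [finWH_of_finite h]; exact ENNReal.ofReal_le_one.2 (wt_le_one _ _)
  · rw [finWH_of_infinite h]; exact zero_le_one

/-- `W^f_x = w(F_x) 1(C_H(x) finite)`. [folklore] -/
def WfH (n : ℕ) (ω : BondConfig (Site 3)) (x : Site 3) : ℝ≥0∞ := finWH n (clusterH ω x)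

open Classical in
/-- `W_x = w(F_x)` if `C_H(x)` is finite, `1` otherwise. [folklore] -/
def WfinH (n : ℕ) (ω : BondConfig (Site 3)) (x : Site 3) : ℝ≥0∞ :=
  if (clusterH ω x).Finite then ENNReal.ofReal (wt n (footN ω x)) else 1

/-- `WfH` for a finite cluster. [folklore] -/
theorem WfH_of_finite {n : ℕ} {ω : BondConfig (Site 3)} {x : Site 3} (h : (clusterH ω x).Finite) :
    WfH n ω x = ENNReal.ofReal (wt n (footN ω x)) := finWH_of_finite h

/-- `WfH` vanishes for an infinite cluster. [folklore] -/
theorem WfH_of_infinite {n : ℕ} {ω : BondConfig (Site 3)} {x : Site 3} (h : ¬ (clusterH ω x).Finite) :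
    WfH n ω x = 0 := finWH_of_infinite h

/-- `WfinH` for a finite cluster. [folklore] -/
theorem WfinH_of_finite {n : ℕ} {ω : BondConfig (Site 3)} {x : Site 3} (h : (clusterH ω x).Finite) :
    WfinH n ω x = ENNReal.ofReal (wt n (footN ω x)) := by simp [WfinH, h]

/-- `WfinH = 1` for an infinite cluster. [folklore] -/
theorem WfinH_of_infinite {n : ℕ} {ω : BondConfig (Site 3)} {x : Site 3} (h : ¬ (clusterH ω x).Finite) :
    WfinH n ω x = 1 := by simp [WfinH, h]

/-- `WfH ≤ 1`. [folklore] -/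
theorem WfH_le_one (n : ℕ) (ω : BondConfig (Site 3)) (x : Site 3) : WfH n ω x ≤ 1 := finWH_le_one n _

/-- `WfinH ≤ 1`. [folklore] -/
theorem WfinH_le_one (n : ℕ) (ω : BondConfig (Site 3)) (x : Site 3) : WfinH n ω x ≤ 1 := by
  by_cases h : (clusterH ω x).Finite
  · rw [WfinH_of_finite h]; exact ENNReal.ofReal_le_one.2 (wt_le_one _ _)
  · rw [WfinH_of_infinite h]

/-- `finWH` of a measurable set-valued map is measurable. [folklore] -/
theorem measurable_finWH_comp (n : ℕ) {S : BondConfig (Site 3) → Set (Site 3)} (hS : Measurable S) :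
    Measurable fun ω => finWH n (S ω) := by
  classical
  have hfin : MeasurableSet {ω : BondConfig (Site 3) | (S ω).Finite} := by
    have : {ω : BondConfig (Site 3) | (S ω).Finite} = (fun ω => (S ω).encard) ⁻¹' {m : ℕ∞ | m < ⊤} := by
      ext ω; simp [Set.encard_lt_top_iff]
    rw [this]
    exact (measurable_encard.comp hS) MeasurableSet.of_discrete
  have hcnt : Measurable fun ω => (S ω ∩ {v : Site 3 | v 0 = 0}).ncard :=
    measurable_ncard.comp (measurable_set_iff.2 fun v => (measurable_set_iff.1 hS v).and measurable_const)
  unfold finWH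
  exact Measurable.ite hfin ((measurable_from_nat (f := fun k : ℕ => ENNReal.ofReal (wt n k))).comp hcnt) measurable_const

/-- `WfH n · x` is measurable. [folklore] -/
theorem measurable_WfH (n : ℕ) (x : Site 3) : Measurable fun ω : BondConfig (Site 3) => WfH n ω x :=
  measurable_finWH_comp n (WallBootstrap.measurable_clusterH x)

/-- `WfinH n · x` is measurable. [folklore] -/
theorem measurable_WfinH (n : ℕ) (x : Site 3) : Measurable fun ω : BondConfig (Site 3) => WfinH n ω x := by
  classical
  unfold WfinH
  exact measurable_ite_nat (measurableSet_finite_clusterH x) (measurable_footN x) (fun k => ENNReal.ofReal (wt n k)) 1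

/-! #### The integrands at the wall bond `e = {0, x}` -/

variable (n : ℕ) (x : Site 3)

/-- The target `1(e closed) 1(x ∉ C_H(0)) W^f_0 W_x`. [cite: Hutchcroft2020Locality, §3, proof of Lemma 3.1] -/
def Tgt (ω : BondConfig (Site 3)) : ℝ≥0∞ :=
  ind {ω | s((0 : Site 3), x) ∉ ω} ω * ind {ω | x ∉ clusterH ω 0} ω * (WfH n ω 0 * WfinH n ω x)

/-- `N^cl_e = 1(e closed)(W^f_0 + 1(0 ∉ C_H(x)) W^f_x)`. [cite: Hutchcroft2020Locality, §3, proof of Lemma 3.1] -/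
def Ncl (ω : BondConfig (Site 3)) : ℝ≥0∞ :=
  ind {ω | s((0 : Site 3), x) ∉ ω} ω * (WfH n ω 0 + ind {ω | (0 : Site 3) ∉ clusterH ω x} ω * WfH n ω x)

/-- `N^op_e = 1(e open) W^f_0`. [cite: Hutchcroft2020Locality, §3, proof of Lemma 3.1] -/
def Nop (ω : BondConfig (Site 3)) : ℝ≥0∞ := ind {ω | s((0 : Site 3), x) ∈ ω} ω * WfH n ω 0

/-- `G_e = w(F(C_H(0) ∪ C_H(x))) 1(both finite)`, independent of `ω(e)`.
[cite: Hutchcroft2020Locality, §3, proof of Lemma 3.1] -/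
def Gfl (ω : BondConfig (Site 3)) : ℝ≥0∞ := finWH n (clusterH ω 0 ∪ clusterH ω x)

variable {n x}

/-- `G_e ≤ 1`. [folklore] -/
theorem Gfl_le_one (ω : BondConfig (Site 3)) : Gfl n x ω ≤ 1 := finWH_le_one n _

/-- **`G_e` does not depend on the state of `e`** (`x ∈ H`). [cite: Hutchcroft2020Locality, §3, proof of Lemma 3.1] -/
theorem Gfl_diff (hx : 0 ≤ x 0) (ω : BondConfig (Site 3)) : Gfl n x (ω \ {s((0 : Site 3), x)}) = Gfl n x ω := by
  simp only [Gfl, union_clusterH_diff_eq (a := (0 : Site 3)) le_rfl hx]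

/-- When `e` is open there is one cluster at `e`: `G_e = W^f_0`. [folklore] -/
theorem Gfl_of_mem (hx : 0 ≤ x 0) (hx0 : x ≠ 0) {ω : BondConfig (Site 3)} (he : s((0 : Site 3), x) ∈ ω) :
    Gfl n x ω = WfH n ω 0 := by
  rw [Gfl, clusterH_eq_of_mk_mem (a := (0 : Site 3)) le_rfl hx hx0.symm he, Set.union_self, WfH]

/-- `1(e open) G_e = N^op_e`. [folklore] -/
theorem ind_mem_mul_Gfl (hx : 0 ≤ x 0) (hx0 : x ≠ 0) (ω : BondConfig (Site 3)) :
    ind {ω | s((0 : Site 3), x) ∈ ω} ω * Gfl n x ω = Nop n x ω := by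
  by_cases he : s((0 : Site 3), x) ∈ ω
  · rw [Nop, Gfl_of_mem hx hx0 he]
  · rw [Nop, ind_of_notMem (show ω ∉ {ω | s((0 : Site 3), x) ∈ ω} from he), zero_mul, zero_mul]

/-- The footprint of a union is at most the sum of the footprints. [folklore] -/
theorem ncard_union_inter_le (A B : Set (Site 3)) :
    ((A ∪ B) ∩ {v : Site 3 | v 0 = 0}).ncard ≤ (A ∩ {v | v 0 = 0}).ncard + (B ∩ {v | v 0 = 0}).ncard := by
  rw [Set.union_inter_distrib_right]; exact Set.ncard_union_le _ _

/-- **The pointwise AKN inequality** (ghost field integrated out, footprint weights):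
`Tgt + 1(e closed) G_e ≤ N^cl_e`. [cite: Hutchcroft2020Locality, §3, proof of Lemma 3.1] -/
theorem Tgt_add_le (ω : BondConfig (Site 3)) :
    Tgt n x ω + ind {ω | s((0 : Site 3), x) ∉ ω} ω * Gfl n x ω ≤ Ncl n x ω := by
  by_cases he : s((0 : Site 3), x) ∈ ω
  · have h0 : ind {ω | s((0 : Site 3), x) ∉ ω} ω = 0 :=
      ind_of_notMem (show ω ∉ {ω | s((0 : Site 3), x) ∉ ω} from fun h => h he)
    simp only [Tgt, Ncl, h0, zero_mul, zero_add, le_refl]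
  have h1 : ind {ω | s((0 : Site 3), x) ∉ ω} ω = 1 := ind_of_mem (show ω ∈ {ω | s((0 : Site 3), x) ∉ ω} from he)
  simp only [Tgt, Ncl, h1, one_mul]
  by_cases hxC : x ∈ clusterH ω 0
  · -- one cluster around the closed bond
    have hK : clusterH ω x = clusterH ω 0 := clusterH_eq_of_mem hxC
    have h0x : (0 : Site 3) ∈ clusterH ω x := mem_clusterH_comm.1 hxC
    rw [ind_of_notMem (show ω ∉ {ω | x ∉ clusterH ω 0} from fun h => h hxC), zero_mul, zero_add,
      ind_of_notMem (show ω ∉ {ω | (0 : Site 3) ∉ clusterH ω x} from fun h => h h0x), zero_mul, add_zero,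
      Gfl, hK, Set.union_self, WfH]
  · have h0x : (0 : Site 3) ∉ clusterH ω x := fun h => hxC (mem_clusterH_comm.1 h)
    rw [ind_of_mem (show ω ∈ {ω | x ∉ clusterH ω 0} from hxC), one_mul,
      ind_of_mem (show ω ∈ {ω | (0 : Site 3) ∉ clusterH ω x} from h0x), one_mul]
    by_cases hf0 : (clusterH ω 0).Finite
    · by_cases hfx : (clusterH ω x).Finite
      · have hU : (clusterH ω 0 ∪ clusterH ω x).Finite := hf0.union hfx
        rw [WfH_of_finite hf0, WfinH_of_finite hfx, WfH_of_finite hfx, Gfl, finWH_of_finite hU,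
          ← ENNReal.ofReal_mul (wt_nonneg _ _),
          ← ENNReal.ofReal_add (mul_nonneg (wt_nonneg _ _) (wt_nonneg _ _)) (wt_nonneg _ _),
          ← ENNReal.ofReal_add (wt_nonneg _ _) (wt_nonneg _ _)]
        exact ENNReal.ofReal_le_ofReal (wt_mul_add_le n (ncard_union_inter_le _ _))
      · have hU : ¬ (clusterH ω 0 ∪ clusterH ω x).Finite := fun h => hfx (h.subset Set.subset_union_right)
        rw [WfH_of_finite hf0, WfinH_of_infinite hfx, WfH_of_infinite hfx, Gfl, finWH_of_infinite hU]
        simp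
    · have hU : ¬ (clusterH ω 0 ∪ clusterH ω x).Finite := fun h => hf0 (h.subset Set.subset_union_left)
      rw [WfH_of_infinite hf0, Gfl, finWH_of_infinite hU]
      simp

/-! #### Measurability and Step 1 -/

/-- `G_e` is measurable. [folklore] -/
theorem measurable_Gfl (n : ℕ) (x : Site 3) : Measurable (Gfl n x) := by
  refine measurable_finWH_comp n (measurable_set_iff.2 fun v => ?_)
  exact (measurable_set_iff.1 (WallBootstrap.measurable_clusterH 0) v).or
    (measurable_set_iff.1 (WallBootstrap.measurable_clusterH x) v)

/-- The target is measurable. [folklore] -/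
theorem measurable_Tgt (n : ℕ) (x : Site 3) : Measurable (Tgt n x) := by
  unfold Tgt
  exact ((measurable_ind (measurableSet_notMem _)).mul
    (measurable_ind (measurableSet_mem_clusterH 0 x).compl)).mul ((measurable_WfH n 0).mul (measurable_WfinH n x))

/-- `N^cl_e` is measurable. [folklore] -/
theorem measurable_Ncl (n : ℕ) (x : Site 3) : Measurable (Ncl n x) := by
  unfold Ncl
  exact (measurable_ind (measurableSet_notMem _)).mul
    ((measurable_WfH n 0).add ((measurable_ind (measurableSet_mem_clusterH x 0).compl).mul (measurable_WfH n x)))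

/-- `N^op_e` is measurable. [folklore] -/
theorem measurable_Nop (n : ℕ) (x : Site 3) : Measurable (Nop n x) := by
  unfold Nop
  exact (measurable_ind (measurableSet_mem _)).mul (measurable_WfH n 0)

/-- **Step 1** (Hutchcroft 2020, Lemma 3.1 up to the mass transport, on the wall): for the wall bond
`e = {0, x}` of probability `q > 0`, `E[Tgt_e] + ((1-q)/q) E[N^op_e] ≤ E[N^cl_e]`.
[cite: Hutchcroft2020Locality, §3, proof of Lemma 3.1] -/
theorem lintegral_Tgt_add_le (p : unitInterval) (lam α : ℝ) (n : ℕ) {x : Site 3} (hx : 0 ≤ x 0) (hx0 : x ≠ 0)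
    (hq : 0 < (augProb p lam α s((0 : Site 3), x) : ℝ)) :
    ∫⁻ ω, Tgt n x ω ∂(augWall p lam α) +
        ENNReal.ofReal ((1 - (augProb p lam α s((0 : Site 3), x) : ℝ)) / (augProb p lam α s((0 : Site 3), x) : ℝ)) *
          ∫⁻ ω, Nop n x ω ∂(augWall p lam α) ≤
      ∫⁻ ω, Ncl n x ω ∂(augWall p lam α) := by
  set P := augWall p lam α with hP
  set q : ℝ := (augProb p lam α s((0 : Site 3), x) : ℝ) with hqdef
  have hq1 : q ≤ 1 := (augProb p lam α s((0 : Site 3), x)).2.2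
  have hG := measurable_Gfl n x
  have hGfin : ∫⁻ ω, Gfl n x ω ∂P ≠ ∞ := by
    refine ne_top_of_le_ne_top ENNReal.one_ne_top ?_
    calc ∫⁻ ω, Gfl n x ω ∂P ≤ ∫⁻ _, 1 ∂P := lintegral_mono fun ω => Gfl_le_one ω
      _ = 1 := by rw [lintegral_const, measure_univ, mul_one]
  have hcl : ∫⁻ ω, ind {ω | s((0 : Site 3), x) ∉ ω} ω * Gfl n x ω ∂P = ENNReal.ofReal (1 - q) * ∫⁻ ω, Gfl n x ω ∂P :=
    lintegral_notMem_mul_of_flip (augProb p lam α) _ hG (Gfl_diff hx) hGfin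
  have hop : ∫⁻ ω, Nop n x ω ∂P = ENNReal.ofReal q * ∫⁻ ω, Gfl n x ω ∂P :=
    calc ∫⁻ ω, Nop n x ω ∂P = ∫⁻ ω, ind {ω | s((0 : Site 3), x) ∈ ω} ω * Gfl n x ω ∂P :=
          lintegral_congr fun ω => (ind_mem_mul_Gfl hx hx0 ω).symm
      _ = ENNReal.ofReal q * ∫⁻ ω, Gfl n x ω ∂P := lintegral_mem_mul_of_flip (augProb p lam α) _ hG (Gfl_diff hx)
  have hqq : ENNReal.ofReal ((1 - q) / q) * ∫⁻ ω, Nop n x ω ∂P = ∫⁻ ω, ind {ω | s((0 : Site 3), x) ∉ ω} ω * Gfl n x ω ∂P := by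
    rw [hcl, hop, ← mul_assoc, ← ENNReal.ofReal_mul (div_nonneg (sub_nonneg.2 hq1) hq.le), div_mul_cancel₀ _ hq.ne']
  rw [hqq, ← lintegral_add_left (measurable_Tgt n x)]
  exact lintegral_mono fun ω => Tgt_add_le ω

end AKN


end WallTwoGhost

open WallTwoGhost in
/-- **K1, part 7 (AKN exchange at one wall bond).** For the wall bond `e = {0,x}` of probability `q > 0`
under the augmented model, `E[Tgt_e] + ((1-q)/q) E[N^op_e] ≤ E[N^cl_e]`: the pointwise identity counting
the finite `H`-clusters at `e` with footprint ghost weights, and the resampling of the single coordinate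
`e` of the product measure. [cite: Hutchcroft2020Locality, §3, proof of Lemma 3.1] -/
theorem wallTwoGhost_akn_step : ∀ (p : unitInterval) (lam α : ℝ) (n : ℕ) (x : Site 3), 0 ≤ x 0 → x ≠ 0 → 0 < (augProb p lam α s((0 : Site 3), x) : ℝ) → ∫⁻ ω, Tgt n x ω ∂(augWall p lam α) + ENNReal.ofReal ((1 - (augProb p lam α s((0 : Site 3), x) : ℝ)) / (augProb p lam α s((0 : Site 3), x) : ℝ)) * ∫⁻ ω, Nop n x ω ∂(augWall p lam α) ≤ ∫⁻ ω, Ncl n x ω ∂(augWall p lam α) :=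
  fun p lam α n _ hx hx0 hq => lintegral_Tgt_add_le p lam α n hx hx0 hq

end Summit.CriticalPhenomena.PercolationContinuityZ3.Theorems
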